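import Summits.ResolutionOfSingularities.ResolutionOfSingularities.Theorems.FrobeniusClosingSteerGeoDictShorts
import Summits.ResolutionOfSingularities.ResolutionOfSingularities.Theorems.FrobeniusClosingSteerRadicandIsolatedOfMinimal
import Mathlib.Algebra.CharP.Subring
import HarnessLib

/-!
# Crux `Steer` (stmt-ResolutionOfSingularities-16345), chain W4.1, R2 σ_top line, piece G⁺ `GeoDictFinrank` (the G OF RECORD,
# plan-1 RULING 06:31:15Z (3)): a dominant tail is an eternal isolated radicand chain of RESIDUE p-RANK `n − c` (Theses-free)

OURS (campaign `res-hironaka`, rung L ★L-G4, slot W4.1, chain W4.1, seat `res-L0-w41-stub-7` = `res-D-pv-011`, holder of G per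
res-L0-w41-plan-1 RULINGS 05:29:17Z (1); replaces the role of no printed item; NOT a statement of the manuscript under review; AI
review is weaker than expert review). Object: `GeoDict` of `L/w41/Sketch-R2-steered.lean` fb4f9514a6cb98fe §3.4 =
`L/w41/R2TwoSigma-r19.snippet.lean` b91538640f6cc999 §σ2.2 (verbatim): a DOMINANT TAIL (`IsDominantTail R P i₀ c`) of an eternal
σ_top-steered run from a core datum yields `¬ NoEternalIsolatedRadicandChain p c` (idea-1's definition, §3.1). G table of record:
res-L0-w41-stub-8's memo 5057b7e099caf6bf (rows G0–G10).

This is the G⁺ re-assembly of res-L0-w41-plan-1 RULING 06:31:15Z (3) (idea-1's `NoEternalIsolatedRadicandChainFinrank p c e`,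
«L/res-L0-w41-idea-1/R2TwoSigma-finAt-addendum.snippet.lean» ccc21c2bfe80aed6 §σ2.13b, VERBATIM: the e-free chain binders + an
explicit `Fact p.Prime` + `[∀ m, CharP (ResidueField (S m)) p]` + ONE extra hypothesis
«`∀ m, Module.finrank (frobenius (ResidueField (S m)) p).fieldRange (ResidueField (S m)) = p ^ e`»; `GeoDictFinrank` = `GeoDict`'s
binders with conclusion `¬ NoEternalIsolatedRadicandChainFinrank p c (n - c)`).
`GeoDict.not_noEternalChainFinrank_of_dominantTail` = the G10 construction (`FrobeniusClosingSteerGeoDict.lean`, p503815) re-run with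
the residue p-rank of EVERY member supplied by the hypothesis `hfin` over the def-free chain-ring interface (res-type-096's G11d brick
produces it: model `SteeredExit.exists_model_of_tower`, `finrank_frobenius_residueField_eq_pow`, height/dimension bookkeeping,
transport along `κ(P) ≃+* ResidueField T`), and the characteristic instance of the residue fields proved here
(`GeoDict.charP_residueField_of_subring`). Otherwise the text below is G10's. `GeoDict.not_noEternalChain_of_dominantTail` (G10) is row G10 with the two sub-pieces held by other seats as HYPOTHESES in their
minimal shapes: **G1** `hregR : ∀ i, IsRegularLocalRing (R i)` (member regularity along the run, res-L0-w41-stub-8 / res-D-pv-036: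
`SteeredMembersRegular`, K-M1 p501181) and the MINIMALITY input of **G9** `hmin` («no singular prime strictly below the centre», the minimality clause of
`IsTopSingComponent` read through `IsSingPrime`), turned into isolatedness of the radicand ring over the chain ring by
res-type-096's LANDED `GeoDict.isRegularLocalRing_localization_atPrime_adjoinRoot_of_forall_lt` (p502861) over the def-free
chain-ring interface `hT : ∀ z, z ∈ T ↔ ∃ a b : R, b ∉ P ∧ z = a / b` (bridge `GeoDict.isLocalization_of_locChar`);
every other binder of the chain is discharged here from the run data (read through `IsSteeredRun` / `IsStrictStepAlong` /
`IsPermissibleCentre` / `IsDominantTail`): chain rings `S m = (R (i₀+m))_{P (i₀+m)} ⊆ K` (`GeoDict.exists_locChar`), `S m ≤ S (m+1)`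
and the quadratic-transform structure (G5 `isQuadraticTransform_of_isLocalBlowupAlong`), `𝔪_{S m}·S (m+1) = (x m)` (G6, with
`exists_mem_mul_of_isExcParamAlong`), regularity (G2, Serre), excellence (G3, `SteeredExit.exists_model_of_tower` + Stacks 07QW/07QU),
dimension `= height = c` (G4), the Frobenius relation `f (m+1)·(x m)^p = f m − (g m)^p` from `s = x·s' + g` (G7), and the cleaned
multiplicity from the permissible centre (G8). The conclusion is `NoEternalIsolatedRadicandChain p c` UNFOLDED verbatim (§3.1,
`HasIsolatedSingularity` / `RadicandRing` unfolded), negated. The by-name leaf for `GeoDict` (G10 proper) follows in the sequel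
file once G1's run-form and G9 have landed, and is kernel-checked against the snippet. [cite: Cutkosky2014, §2.1]
[cite: NovacoskiSpivakovsky2014, Def. 2.11] [cite: Matsumura1987, Thm. 19.3] [cite: StacksProject, Tag 07QU] [folklore]
-/

noncomputable section

-- `Summit.<S>.<S>.…` duplicates the summit name by design (single-problem summit).
set_option linter.dupNamespace false

open Polynomial IsLocalRing

namespace Summit.ResolutionOfSingularities.ResolutionOfSingularities.Theorems.SwitchingDichotomy

open Literature.AlgebraicGeometry.Resolution

namespace GeoDict

/-- Residue fields of local subrings of a characteristic-`p` field have characteristic `p` (= idea-1's `charP_residueField_subring`).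
[folklore] -/
theorem charP_residueField_of_subring (p : ℕ) [Fact p.Prime] {L : Type*} [Field L] [CharP L p] (S : Subring L)
    [IsLocalRing S] : CharP (ResidueField S) p := by
  have h0 : ((p : ℕ) : ResidueField S) = 0 := by
    have : ((p : ℕ) : S) = 0 := by exact_mod_cast (CharP.cast_eq_zero S p)
    rw [← map_natCast (IsLocalRing.residue S) p, this, map_zero]
  exact (CharP.charP_iff_prime_eq_zero Fact.out).mpr h0

/-- **G⁺ core (finrank form) — a dominant tail of a σ_top-steered run is an eternal isolated radicand chain of codimension `c` and
residue p-rank `e` at every member**, given member regularity (G1), the minimality input of G9, and the per-member residue p-rank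
`hfin` (G11d) as hypotheses; all other chain binders (and the characteristic instances of the residue fields) are produced here. The
negated statement is idea-1's `NoEternalIsolatedRadicandChainFinrank p c e` (§σ2.13b), unfolded verbatim; the skeleton uses `e = n - c`.
[cite: Cutkosky2014, §2.1] [cite: Matsumura1987, Thm. 19.3] [cite: StacksProject, Tag 07QU] [folklore] -/
theorem not_noEternalChainFinrank_of_dominantTail (p : ℕ) [hp : Fact p.Prime] {k K : Type} [Field k] [Field K] [Algebra k K]
    [CharP K p] (O : ValuationSubring K) (A₀ : Subalgebra k K) (h₀ : A₀.toSubring ≤ O.toSubring) (hfg : A₀.FG)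
    (R : ℕ → Subring K) (P : (i : ℕ) → Ideal (R i)) (s : ℕ → K) (i₀ c e : ℕ)
    (hR0 : R 0 = locAtCentre A₀.toSubring O)
    (hbl : ∀ i, IsLocalBlowupAlong O (R i) (P i) (R (i + 1)))
    (hst : ∀ i, ∃ x g : K, ((∃ hx : x ∈ R i, (⟨x, hx⟩ : R i) ∈ P i) ∧ x ≠ 0 ∧
      ∀ y : R i, y ∈ P i → O.valuation (y : K) ≤ O.valuation x) ∧ g ∈ R i ∧ s i = x * s (i + 1) + g)
    (hsp : ∀ i, s i ^ p ∈ R i)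
    (hprime : ∀ i, i₀ ≤ i → (P i).IsPrime)
    (hmult : ∀ i, i₀ ≤ i → ∃ g : R i, (⟨s i ^ p, hsp i⟩ : R i) - g ^ p ∈ P i ^ p)
    (hht : ∀ i, i₀ ≤ i → (P i).height = c)
    (hcomap : ∀ i, i₀ ≤ i → ∃ h : R i ≤ R (i + 1), Ideal.comap (Subring.inclusion h) (P (i + 1)) = P i)
    (hregR : ∀ i, IsRegularLocalRing (R i))
    (hmin : ∀ i, i₀ ≤ i → ∀ (Q : Ideal (R i)) [Q.IsPrime], Q < P i →
      IsRegularLocalRing (AdjoinRoot ((X : (Localization.AtPrime Q)[X]) ^ p -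
        C (algebraMap (R i) (Localization.AtPrime Q) ⟨s i ^ p, hsp i⟩))))
    (hfin : ∀ i, i₀ ≤ i → ∀ (T : Subring K) [IsLocalRing T] [CharP (ResidueField T) p],
      (∀ z : K, z ∈ T ↔ ∃ a b : R i, b ∉ P i ∧ z = (a : K) / b) →
      Module.finrank (frobenius (ResidueField T) p).fieldRange (ResidueField T) = p ^ e) :
    ¬ (∀ (_ : Fact p.Prime) (L : Type) [Field L] [CharP L p] (S : ℕ → Subring L) [∀ m, IsLocalRing (S m)]
        [∀ m, CharP (ResidueField (S m)) p]
        (hle : ∀ m, S m ≤ S (m + 1)) (f g : ∀ m, S m) (x : ∀ m, S (m + 1)),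
        (∀ m, IsRegularLocalRing (S m)) → (∀ m, IsExcellentRing (S m)) → (∀ m, ringKrullDim (S m) = c) →
        (∀ m, Module.finrank (frobenius (ResidueField (S m)) p).fieldRange (ResidueField (S m)) = p ^ e) →
        (∀ m, IsQuadraticTransform (S m) (S (m + 1))) →
        (∀ m, Ideal.span ((fun y : S m => (⟨(y : L), hle m y.2⟩ : S (m + 1))) ''
            (maximalIdeal (S m) : Set (S m))) = Ideal.span {x m}) →
        (∀ m, ((f (m + 1) : S (m + 1)) : L) * ((x m : S (m + 1)) : L) ^ p =
            ((f m : S m) : L) - ((g m : S m) : L) ^ p) →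
        (∀ m, ∃ h : S m, f m - h ^ p ∈ maximalIdeal (S m) ^ p) →
        (∀ m, ∀ (Q : Ideal (AdjoinRoot ((X : (S m)[X]) ^ p - C (f m)))) [Q.IsPrime],
            (∃ Q' : Ideal (AdjoinRoot ((X : (S m)[X]) ^ p - C (f m))), Q'.IsPrime ∧ Q < Q') →
            IsRegularLocalRing (Localization.AtPrime Q)) →
        False) := by
  intro hNo
  -- ### indices on the tail
  have hi : ∀ m, i₀ ≤ i₀ + m := fun m => Nat.le_add_right _ _
  haveI hpr : ∀ m, (P (i₀ + m)).IsPrime := fun m => hprime _ (hi m)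
  haveI hpr' : ∀ m, (P (i₀ + m + 1)).IsPrime := fun m => hprime _ (by omega)
  -- ### the chain rings `S m = (R (i₀+m))_{P (i₀+m)} ⊆ K`
  have hTex : ∀ m, ∃ T : Subring K, ∀ z : K, z ∈ T ↔ ∃ a b : R (i₀ + m), b ∉ P (i₀ + m) ∧ z = (a : K) / b :=
    fun m => exists_locChar (R (i₀ + m)) (P (i₀ + m))
  choose S hS using hTex
  haveI hSloc : ∀ m, IsLocalRing (S m) := fun m => isLocalRing_of_locChar (hS m)
  have hRS : ∀ m, R (i₀ + m) ≤ S m := fun m => le_of_locChar (hS m)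
  -- ### `S m ≤ S (m+1)` by domination `P (i+1) ∩ R i = P i`
  have hcm : ∀ m, ∃ h : R (i₀ + m) ≤ R (i₀ + m + 1),
      Ideal.comap (Subring.inclusion h) (P (i₀ + m + 1)) = P (i₀ + m) := fun m => hcomap _ (hi m)
  choose hRR hPP using hcm
  have hle : ∀ m, S m ≤ S (m + 1) := fun m => le_of_locChar_of_comap (hRR m) (hPP m) (hS m) (hS (m + 1))
  -- ### the strict-transform data
  choose xx gg hxg using hst
  have hxR : ∀ i, xx i ∈ R i := fun i => (hxg i).1.1.1
  have hxP : ∀ i, (⟨xx i, hxR i⟩ : R i) ∈ P i := fun i => (hxg i).1.1.2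
  have hx0 : ∀ i, xx i ≠ 0 := fun i => (hxg i).1.2.1
  have hxmax : ∀ i, ∀ y : R i, y ∈ P i → O.valuation (y : K) ≤ O.valuation (xx i) := fun i => (hxg i).1.2.2
  have hgR : ∀ i, gg i ∈ R i := fun i => (hxg i).2.1
  have hsx : ∀ i, s i = xx i * s (i + 1) + gg i := fun i => (hxg i).2.2
  -- ### the chain data
  let f : ∀ m, S m := fun m => ⟨s (i₀ + m) ^ p, hRS m (hsp _)⟩
  let g : ∀ m, S m := fun m => ⟨gg (i₀ + m), hRS m (hgR _)⟩
  let x : ∀ m, S (m + 1) := fun m => ⟨xx (i₀ + m), hle m (hRS m (hxR _))⟩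
  haveI hSchar : ∀ m, CharP (ResidueField (S m)) p := fun m => charP_residueField_of_subring p (S m)
  refine @hNo hp K _ _ S hSloc hSchar hle f g x (fun m => ?_) (fun m => ?_) (fun m => ?_)
    (fun m => hfin _ (hi m) (S m) (hS m)) (fun m => ?_) (fun m => ?_) (fun m => ?_) (fun m => ?_) (fun m => ?_)
  · -- G2 regularity (Serre)
    haveI := hregR (i₀ + m)
    exact isRegularLocalRing_of_locChar (hS m)
  · -- G3 excellence (model + Stacks 07QW/07QU)
    obtain ⟨A₁, -, -, hfg₁, hRA₁⟩ := SteeredExit.exists_model_of_tower O A₀ h₀ hfg hR0 (N := i₀ + m)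
      fun i _ => (hbl i).isLocalBlowup
    exact isExcellentRing_of_locChar O A₁ hfg₁ hRA₁ (hS m)
  · -- G4 dimension = height = c
    rw [ringKrullDim_of_locChar (hS m), hht _ (hi m)]
    rfl
  · -- G5 quadratic transform
    exact isQuadraticTransform_of_isLocalBlowupAlong (hbl (i₀ + m)) (hRR m) (hPP m) (hS m) (hS (m + 1))
  · -- G6 the exceptional parameter generates `𝔪_{S m}·S (m+1)`
    have hdiv := exists_mem_mul_of_isExcParamAlong (hbl (i₀ + m)) ⟨hxR _, hxP _⟩ (hx0 _) (hxmax _)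
    exact span_image_maximalIdeal_eq_of_locChar (hRR m) (hPP m) (hS m) (hS (m + 1)) (hle m)
      ⟨xx (i₀ + m), hxR _⟩ (hxP _) hdiv (hle m (hRS m (hxR _)))
  · -- G7 the Frobenius relation from `s = x·s' + g`
    show (s (i₀ + m + 1) ^ p) * xx (i₀ + m) ^ p = s (i₀ + m) ^ p - gg (i₀ + m) ^ p
    have h := hsx (i₀ + m)
    have : s (i₀ + m) - gg (i₀ + m) = xx (i₀ + m) * s (i₀ + m + 1) := by rw [h]; ring
    rw [← sub_pow_char, this, mul_pow, mul_comm]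
  · -- G8 cleaned multiplicity from the permissible centre
    obtain ⟨g₀, hg₀⟩ := hmult _ (hi m)
    refine ⟨⟨(g₀ : K), hRS m g₀.2⟩, ?_⟩
    have hmem := mem_maximalIdeal_pow_of_locChar (hS m) hg₀
    have heq : f m - ⟨(g₀ : K), hRS m g₀.2⟩ ^ p =
        ⟨(((⟨s (i₀ + m) ^ p, hsp _⟩ : R (i₀ + m)) - g₀ ^ p : R (i₀ + m)) : K),
          le_of_locChar (hS m) ((⟨s (i₀ + m) ^ p, hsp _⟩ : R (i₀ + m)) - g₀ ^ p).2⟩ := Subtype.ext rfl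
    rw [heq]
    exact hmem
  · -- G9 isolatedness from minimality (res-type-096, p502861), over `S m` as the localisation at `P (i₀+m)`
    intro Q hQp hQ
    haveI : Q.IsPrime := hQp
    letI : Algebra (R (i₀ + m)) (S m) := (Subring.inclusion (hRS m)).toAlgebra
    haveI : IsLocalization.AtPrime (S m) (P (i₀ + m)) := isLocalization_of_locChar (hS m) fun r => rfl
    exact @isRegularLocalRing_localization_atPrime_adjoinRoot_of_forall_lt (R (i₀ + m)) _ p _
      (⟨s (i₀ + m) ^ p, hsp _⟩ : R (i₀ + m)) (P (i₀ + m)) _ (S m) _ _ _ _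
      (fun Q' hQ'p hQ' => by haveI := hQ'p; exact hmin _ (hi m) Q' hQ') Q hQp hQ

end GeoDict

end Summit.ResolutionOfSingularities.ResolutionOfSingularities.Theorems.SwitchingDichotomy

end
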